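import Mathlib
import HarnessLib
import Summits.HubbardSuperconductivity.HubbardSuperconductivity.Theorems.KLProgrammeKLRegimeTwoVolumeLipBornDiffKitUnits
import Summits.HubbardSuperconductivity.HubbardSuperconductivity.Theorems.KLProgrammeKLRegimeEngineTowerLipschitzKitMerge

/-!
# Route `KLProgramme` — crux K3 ENGINE (stmt-HubbardSuperconductivity-20437), stub (e) proof-input «(e)-D-ROWS», (M3)+(M7): THE (Db) ROW AS THE LITERAL
# LIPSCHITZ STEP `hstep` OF `EngineV8.towerBornDiff_le_law_of_profile_tok` AT THE MODEL (up to the division by the born unit)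
# (seat hubbard-kl-k3c4-p1 g24; `--supports` 20437; DROWS-SCOPE-g24 v9 §11.2 + the merge correction)

`…TwoVolumeLipBornDiffKitUnits.klLipBornDiff_pinned_le_kit_units` bounds the born difference of block `k` at a deep pin by
`cW^{2q−1}(u^qKc)(cW·Ŝ₂(bE;μ̂₁) + cWΛ⁻¹·Ŝ_{2Λ}(bD;μ̂₂) + τ·Ŝ₂(bD;μ̂₂)) + SRC` (`μ̂₁ = bV+bD+bE`, `μ̂₂ = bV+bD`, `τ = cW·t`, `t = 1/(1+Λ_T(r+1))`), and
`…EngineTowerLipschitzKitMerge.lipKitBrackets_le_merged` merges the three brackets into ONE Lipschitz step with the difference array `ν := bE + (Λ⁻¹ + t)·bD` and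
`Ct := 4 + 2t`.  Result (pin level; degree `n + 1 = 2q`, `(D₀+r)`-deep pin):

  `Σ‖kernel (klLipBornDiff … d k)‖ ≤ cW^{2q−1}·(u^q Kc)·cW·[towerFO D σ̂ ν q + Σ_{n′∈[2,N₀−1]} eΦ̂^{n′−1}ψ̂^q·towerSLip D τ̂ ν μ̂₁ n′ q + (4+2t)·ψ̂^q e V̂(Φ̂V̂)^{N₀−1}/(1−Φ̂V̂)] + SRC`,

`(σ̂, τ̂, Φ̂, ψ̂) = (κ²u, (e²(κ+ρ))²u, (eα/κ²)Kc, ρ⁻²/u)`, `V̂ = towerV D τ̂ μ̂₁` — i.e. after dividing by the born unit `cW^{2q}·u^q·Kc` exactly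
`db (k+1) q ≤ towerFO D σ̂ (dμ k) q + Σ eΦ̂^{n−1}ψ̂^q towerSLip D τ̂ (dμ k) (μb k) n q + Ct·(tail) + src k q` with `dμ k := bE + (Λ⁻¹+t)·bD`, `μb k := bV+bD+bE`,
`src k q := SRC/(cW^{2q}u^qKc)`, for EVERY truncation `N₀ ≥ 2` (the door holds for all `N₀`), as `towerBornDiff_le_law_of_profile_tok` requires.  The array
`(Λ⁻¹+t)·bD` is one-volume four-piece data times the depth gains of block `k`; the bridge `…EngineTowerLipschitzBridge.hprofd_of_remeasured` charges it to the budget.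

* **`klLipBornDiff_pinned_le_hstep`** — the displayed bound (`0 < cW`).

A composition of landed theorems; nothing asserts the (D) rows, stub (e), VL, K3 or superconductivity.
References: BGM 2006 §2.8 (2.83)–(2.90), §3 [cite: BenfattoGiulianiMastropietro2006]; Gawȩdzki–Kupiainen 1985 §3.
-/

noncomputable section

namespace Summit.HubbardSuperconductivity.HubbardSuperconductivity.Theorems.TwoVolumeLip

set_option linter.dupNamespace false -- summit = problem name (single-conjunct summit), D-0017

open Finset Literature.MathematicalPhysics.QuantumLattice GrassmannAlgebra Literature.Probability.LatticeModels
  Literature.Probability.LatticeModels.BattleFederbush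
open Literature.MathematicalPhysics.QuantumLattice.FermiRG
open Summit.HubbardSuperconductivity.HubbardSuperconductivity.Theorems.KLRegimeSplit
open Summit.HubbardSuperconductivity.HubbardSuperconductivity.Theorems.KLProgrammeLegKernels
open Summit.HubbardSuperconductivity.HubbardSuperconductivity.Theorems.DispersionFlow
open Summit.HubbardSuperconductivity.HubbardSuperconductivity.Theorems.EngineV8
open Summit.HubbardSuperconductivity.HubbardSuperconductivity.Theorems.TwoVolumeSource
open Summit.HubbardSuperconductivity.HubbardSuperconductivity.Theorems.TwoVolumeDefect

variable {L b M : ℕ} [NeZero L] [NeZero (b * L)] [NeZero M]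

set_option maxHeartbeats 400000 in -- kit-units row + merge in one declaration
/-- **The (Db) row as the Lipschitz step of the profile-form kit at the model** (see the module docstring; hypotheses of
`klLipBornDiff_pinned_le_kit_units` with `0 < cW`). -/
theorem klLipBornDiff_pinned_le_hstep {β : ℝ} (hβ : 0 < β) (U μ : ℝ) (K : TrigPolyC4v) {d k : ℕ} (hdk : 1 ≤ d * k)
    (hZf : hubbardEffPartitionFnCT (b * L) M β U μ 0 K (klScale klE0 (d * k)) ≠ 0)
    (hZc : hubbardEffPartitionFnCT L M β U μ 0 K (klScale klE0 (d * k)) ≠ 0)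
    {κ : ℝ} (hκ : 0 < κ) (hGB : IsGramBoundedR ((sectorSubMatrix (b * L) M β (bgmFatMultiplier (b * L) M klE0 β (nambuXiCT (b * L) μ K) (d * k - 1))).transpose * hubbardCovSliceCT (b * L) M β μ 0 K (klScale klE0 (d * (k + 1))) (klScale klE0 (d * k)) * sectorSubMatrix (b * L) M β (bgmFatMultiplier (b * L) M klE0 β (nambuXiCT (b * L) μ K) (d * k - 1))) κ)
    {u Kc : ℝ} (hu : 0 < u) (hKc : 0 < Kc) (bV bD : ℕ → ℝ) (hbV0 : ∀ m', 0 ≤ bV m') (hbD0 : ∀ m', 0 ≤ bD m')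
    (hNV : ∀ m' (j : Fin (2 * m')) (x : (SpaceTimeIdx (b * L) M × SectorLeg (sectorCount (d * k - 1)))), ∑ Y ∈ univ.filter (fun Y : Fin (2 * m') → (SpaceTimeIdx (b * L) M × SectorLeg (sectorCount (d * k - 1))) => Y j = x),
      ‖kernel ℂ (klGlue L b M (sectorCount (d * k - 1)) (klLipInput L M β U μ K d k)) (2 * m') Y‖ * klGluedWt L b M β (d * k - 1) (sectorCount (d * k - 1)) (univ.image Y) ≤ Kc * (u ^ m' * bV m'))
    (hND : ∀ m' (j : Fin (2 * m')) (x : (SpaceTimeIdx (b * L) M × SectorLeg (sectorCount (d * k - 1)))), ∑ Y ∈ univ.filter (fun Y : Fin (2 * m') → (SpaceTimeIdx (b * L) M × SectorLeg (sectorCount (d * k - 1))) => Y j = x),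
      ‖kernel ℂ (klLipInputDiff L b M β U μ K d k) (2 * m') Y‖ * klGluedWt L b M β (d * k - 1) (sectorCount (d * k - 1)) (univ.image Y) ≤ Kc * (u ^ m' * bD m'))
    (R R' : ℕ) (bE : ℕ → ℝ) (hbE0 : ∀ m', 0 ≤ bE m') (hE : ∀ m', klLipInputDiffSup L b M β U μ K d k (2 * m') R ≤ Kc * (u ^ m' * bE m'))
    (hbV00 : bV 0 = 0) (hbD00 : bD 0 = 0) (hbE00 : bE 0 = 0)
    {α : ℝ} (hα : 0 < α)
    (hrow : ∀ X, ∑ Y, ‖((sectorSubMatrix (b * L) M β (bgmFatMultiplier (b * L) M klE0 β (nambuXiCT (b * L) μ K) (d * k - 1))).transpose * hubbardCovSliceCT (b * L) M β μ 0 K (klScale klE0 (d * (k + 1))) (klScale klE0 (d * k)) * sectorSubMatrix (b * L) M β (bgmFatMultiplier (b * L) M klE0 β (nambuXiCT (b * L) μ K) (d * k - 1))) X Y‖ * klGluedWt L b M β (d * k - 1) (sectorCount (d * k - 1)) {X, Y} ≤ α)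
    (hcol : ∀ Y, ∑ X, ‖((sectorSubMatrix (b * L) M β (bgmFatMultiplier (b * L) M klE0 β (nambuXiCT (b * L) μ K) (d * k - 1))).transpose * hubbardCovSliceCT (b * L) M β μ 0 K (klScale klE0 (d * (k + 1))) (klScale klE0 (d * k)) * sectorSubMatrix (b * L) M β (bgmFatMultiplier (b * L) M klE0 β (nambuXiCT (b * L) μ K) (d * k - 1))) X Y‖ * klGluedWt L b M β (d * k - 1) (sectorCount (d * k - 1)) {X, Y} ≤ α)
    {ρ : ℝ} (hρ : 0 < ρ)
    {D : ℕ} (hD : Fintype.card (SpaceTimeIdx (b * L) M × SectorLeg (sectorCount (d * k - 1))) / 2 ≤ D)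
    (hg₁ : Real.exp 1 * α / κ ^ 2 * Kc * towerV D ((Real.exp 2 * (κ + ρ)) ^ 2 * u) (fun m => bV m + bD m + bE m) < 1)
    (hg₂ : Real.exp 1 * α / κ ^ 2 * Kc * towerV D ((Real.exp 2 * (κ + ρ)) ^ 2 * u) (fun m => bV m + bD m) < 1)
    {N₀ : ℕ} (hN₀ : 2 ≤ N₀)
    {Λ : ℝ} (hΛ1 : 1 ≤ Λ) (hΛle : Λ ≤ 1 + klScale klE0 (d * k - 1) * ((R' : ℝ) + 1))
    (jr : ℕ) {ΛT cW : ℝ} (hΛT : 0 ≤ ΛT) (hΛr : ΛT ≤ klScale klE0 jr) (hcW : 0 < cW)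
    (hrowT : ∀ x, ∑ y', ‖klLipTransfer (b * L) M β μ K d k x y'‖ *
      klScaleWt (b * L) M β jr {latticeLegPos (2 * (2 * M)) x, latticeLegPos (2 * (2 * M)) y'} ≤ cW)
    (hcolT : ∀ y', ∑ x, ‖klLipTransfer (b * L) M β μ K d k x y'‖ *
      klScaleWt (b * L) M β jr {latticeLegPos (2 * (2 * M)) x, latticeLegPos (2 * (2 * M)) y'} ≤ cW)
    (D₀ r : ℕ) (hD₀ : 2 * r ≤ D₀) (hRR' : R + R' ≤ D₀)
    {n q : ℕ} (hq : 2 * q = n + 1)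
    {N Nfar Es NDs : ℝ} (hN0 : 0 ≤ N) (hNfar0 : 0 ≤ Nfar) (hEs0 : 0 ≤ Es) (hNDs0 : 0 ≤ NDs)
    (hN : ∀ (p : Fin (n + 1)) y, ∑ Y ∈ univ.filter (fun Y : Fin (n + 1) → SpaceTimeIdx L M × SectorLeg (sectorCount (d * k - 1)) => Y p = y),
      ‖kernel ℂ (effAction ℂ (klLipCov L M β μ K d k) (klLipInput L M β U μ K d k) - klLipInput L M β U μ K d k) (n + 1) Y‖ ≤ N)
    (hNfar : ∀ (p : Fin (n + 1)) y (i : Fin (n + 1)),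
      ∑ Y ∈ univ.filter (fun Y : Fin (n + 1) → SpaceTimeIdx L M × SectorLeg (sectorCount (d * k - 1)) => Y p = y ∧ r < Torus.tnorm ((Y p).1.2 - (Y i).1.2)),
        ‖kernel ℂ (effAction ℂ (klLipCov L M β μ K d k) (klLipInput L M β U μ K d k) - klLipInput L M β U μ K d k) (n + 1) Y‖ ≤ Nfar)
    (hEs : ∀ (p : Fin (n + 1)) (y' : SpaceTimeIdx (b * L) M × SectorLeg (sectorCount (d * k - 1))), y' ∈ klDeepPins L D₀ →
      ∑ Y' ∈ univ.filter (fun Y' : Fin (n + 1) → SpaceTimeIdx (b * L) M × SectorLeg (sectorCount (d * k - 1)) => Y' p = y'),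
        ‖kernel ℂ ((effAction ℂ (klLipCov (b * L) M β μ K d k) (klGlue L b M (sectorCount (d * k - 1)) (klLipInput L M β U μ K d k)) -
              klGlue L b M (sectorCount (d * k - 1)) (klLipInput L M β U μ K d k)) -
            klGlue L b M (sectorCount (d * k - 1))
              (effAction ℂ (klLipCov L M β μ K d k) (klLipInput L M β U μ K d k) - klLipInput L M β U μ K d k)) (n + 1) Y'‖ ≤ Es)
    (hNDs : ∀ (p : Fin (n + 1)) (y' : SpaceTimeIdx (b * L) M × SectorLeg (sectorCount (d * k - 1))),
      ∑ Y' ∈ univ.filter (fun Y' : Fin (n + 1) → SpaceTimeIdx (b * L) M × SectorLeg (sectorCount (d * k - 1)) => Y' p = y'),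
        ‖kernel ℂ ((effAction ℂ (klLipCov (b * L) M β μ K d k) (klGlue L b M (sectorCount (d * k - 1)) (klLipInput L M β U μ K d k)) -
              klGlue L b M (sectorCount (d * k - 1)) (klLipInput L M β U μ K d k)) -
            klGlue L b M (sectorCount (d * k - 1))
              (effAction ℂ (klLipCov L M β μ K d k) (klLipInput L M β U μ K d k) - klLipInput L M β U μ K d k)) (n + 1) Y'‖ ≤ NDs)
    (p : Fin (n + 1)) (w'' : SpaceTimeIdx (b * L) M × SectorLeg (sectorCount (d * k))) (hw'' : w'' ∈ klDeepPins L (D₀ + r)) :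
    ∑ X'' ∈ univ.filter (fun X'' : Fin (n + 1) → SpaceTimeIdx (b * L) M × SectorLeg (sectorCount (d * k)) => X'' p = w''),
        ‖kernel ℂ (klLipBornDiff L b M β U μ K d k) (n + 1) X''‖ ≤
      cW ^ (2 * q - 1) * (u ^ q * Kc) * (cW *
        (towerFO D (κ ^ 2 * u) (fun m => bE m + (Λ⁻¹ + 1 / (1 + ΛT * ((r : ℝ) + 1))) * bD m) q +
          (∑ n' ∈ Icc 2 (N₀ - 1), Real.exp 1 * (Real.exp 1 * α / κ ^ 2 * Kc) ^ (n' - 1) * (ρ⁻¹ ^ 2 / u) ^ q * towerSLip D ((Real.exp 2 * (κ + ρ)) ^ 2 * u) (fun m => bE m + (Λ⁻¹ + 1 / (1 + ΛT * ((r : ℝ) + 1))) * bD m) (fun m => bV m + bD m + bE m) n' q) +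
          (4 + 2 * (1 / (1 + ΛT * ((r : ℝ) + 1)))) * ((ρ⁻¹ ^ 2 / u) ^ q * Real.exp 1 * towerV D ((Real.exp 2 * (κ + ρ)) ^ 2 * u) (fun m => bV m + bD m + bE m) *
            ((Real.exp 1 * α / κ ^ 2 * Kc) * towerV D ((Real.exp 2 * (κ + ρ)) ^ 2 * u) (fun m => bV m + bD m + bE m)) ^ (N₀ - 1) / (1 - (Real.exp 1 * α / κ ^ 2 * Kc) * towerV D ((Real.exp 2 * (κ + ρ)) ^ 2 * u) (fun m => bV m + bD m + bE m))))) +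
      (cW ^ n * (cW * Es + cW / (1 + ΛT * ((r : ℝ) + 1)) * NDs) +
        (2 * cW ^ n * (cW / (1 + ΛT * ((r : ℝ) + 1))) * N + n * cW ^ n * (5 * (cW / (1 + ΛT * ((r : ℝ) + 1))) * N + 2 * cW * Nfar))) := by
  have h := klLipBornDiff_pinned_le_kit_units hβ U μ K hdk hZf hZc hκ hGB hu hKc bV bD hbV0 hbD0 hNV hND R R' bE hbE0 hE hbV00 hbD00 hbE00 hα hrow hcol
    hρ hD hg₁ hg₂ hN₀ hΛ1 hΛle jr hΛT hΛr hcW.le hrowT hcolT D₀ r hD₀ hRR' hq hN0 hNfar0 hEs0 hNDs0 hN hNfar hEs hNDs p w'' hw''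
  have ht : 0 ≤ 1 / (1 + ΛT * ((r : ℝ) + 1)) := by positivity
  have hτ : cW / (1 + ΛT * ((r : ℝ) + 1)) = cW * (1 / (1 + ΛT * ((r : ℝ) + 1))) := by ring
  have hμ₁₂ : ∀ m, (fun m => bV m + bD m) m ≤ (fun m => bV m + bD m + bE m) m := fun m => by have := hbE0 m; dsimp only; linarith
  have hμ₂0 : ∀ m, 0 ≤ (fun m => bV m + bD m) m := fun m => add_nonneg (hbV0 m) (hbD0 m)
  have hmerge := lipKitBrackets_le_merged (D := D) (N := N₀ - 1) (q := q) (σ := κ ^ 2 * u) (τ := (Real.exp 2 * (κ + ρ)) ^ 2 * u)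
    (Φ := Real.exp 1 * α / κ ^ 2 * Kc) (ψ := ρ⁻¹ ^ 2 / u) (Λ := Λ) (t := 1 / (1 + ΛT * ((r : ℝ) + 1))) (bE := bE) (bD := bD)
    (μ₁ := fun m => bV m + bD m + bE m) (μ₂ := fun m => bV m + bD m) (by positivity) (by positivity) (by positivity) (one_pos.trans_le hΛ1) ht
    hbD0 hμ₂0 hμ₁₂ hg₁
  have hpre : 0 ≤ cW ^ (2 * q - 1) * (u ^ q * Kc) * cW := by have := hcW.le; positivity
  refine h.trans ?_
  rw [hτ]
  nlinarith [mul_le_mul_of_nonneg_left hmerge hpre]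

end Summit.HubbardSuperconductivity.HubbardSuperconductivity.Theorems.TwoVolumeLip

end
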